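import Summits.QuantumFields.YangMills.Theorems.BalabanUVNodesN19TiltPathRoad

/-!
# BalabanUVNodes ∕ N19 — THE ANNEALED (TILT-PATH) ROAD, IV: THE ANNEALED DATA INHABIT THE H1L ROUTE's NAMED OUTPUT `Spine.NE7.PathLeaf`
# (the DRESSED mass along a tilt path is a positive C¹ path whose log-derivative is within `e^{2l₀B}·osc + r₁` of the class-free drift)

Cell `pub-ymgap` (HUMAN RULING D-0062, Track A), node N19 = NE7, R134 seat `pub-ymgap-dag-n19-c` (g9); bus INTENT-18 (l.17434, announced with FILED-17-I).
Filed `--kind proof --supports` K3⁗ `SpineGivenEndpointR13Sep` = stmt-QuantumFields-20292 `--as helper`.  COUNT-NEUTRAL.  THEOREMS ONLY (0 `def`); imports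
module III `…N19TiltPathRoad` (hence I, II, 16a∕16b) and cites `Spine/NE7/Targets` (`PathLeaf`, `core_of_pathLeaf`) and t4 `T4VarianceMatching.integral_withDensity_ofReal_mul`
BY NAME; edits nothing.

THE POINT.  The H1L route of record for `Spine.NE7.Core` (ROUTES-NE7 §L1.1, typed as `Spine.NE7.PathLeaf` in `Spine/NE7/Targets` §3) asks, per good term and
per `t`, for a POSITIVE C¹ PATH from run A's dressed core to run B's whose logarithmic derivative stays within `vol·δ_K` of ONE `t`- and class-free drift.
Modules I–III's annealed tilt-path data DELIVER such paths: the dressed mass `σ ↦ ∫ e^{Ψ K τ σ + t·W K} dμA K τ` runs from `P K t τ = mgf (W K) (μA K τ) t`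
to `Q K t τ = mgf (W K) (μB K τ) t` (`μB = e^{Ψ_1}·μA`), is positive and differentiable, and its log-derivative is the DRESSED tilted mean of the direction
`Ψ′`, which differs from the undressed one by at most `e^{2|t|B}`× the L¹-oscillation (a bounded re-tilt moves a mean by `≤ e^{2C}·osc`, §1).  So
DRIFT(r₁) ∧ OSC(2ρ) ⇒ `PathLeaf` with drift `φ = k_K` and width `r₁ + 2e^{2l₀B}ρ`, whence `Core` by the tree's `core_of_pathLeaf` — the bookkeeping twin of
module III's `core_of_tiltPath` (there the dressing is INTEGRATED through TV, constant `e^{2l₀B} − 1`; here it is DIFFERENTIATED along the path).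

WHAT IS PROVED ([folklore]).
* §1 `abs_integral_tilted_sub_integral_le_exp_mul_osc`: for a probability law `ν`, integrable `g`, bounded measurable re-tilt `|V| ≤ C`:
  `|∫g d(ν.tilted V) − ∫g dν| ≤ e^{2C}·∫|g − ∫g dν| dν` (the difference is `Cov_ν(e^{V}, g) ∕ E_ν[e^{V}]`; module I `abs_cov_le_mul_integral_abs_sub`).
* §2 ONE CLASS: `tiltPath_bounds_add_dressing` · ★ `dressedMass_hasDerivAt` (positivity, derivative, log-derivative = dressed tilted mean; module I §1 on the
  shifted exponent `ψ_u + tW`) · ★ `abs_dressedDrift_le` (§1 + Mathlib `tilted_tilted`).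
* §3 CLASS LEVEL: ★★ `pathLeaf_of_tiltPath` (module III's data with the good classes NON-NULL — `PathLeaf` demands positive paths — and
  `r₁ K + 2e^{2l₀B}ρ K ≤ vol·δ K` ⇒ `Spine.NE7.PathLeaf l₀ vol T Bad P Q δ`) · `core_of_tiltPath_via_pathLeaf` (= `core_of_pathLeaf ∘` the previous).

HONEST FRAMING.  [folklore] calculus on hypothesis SHAPES; the paths are built from HYPOTHESISED tilt-path data (NODE O ∕ U3 objects, produced by nobody);
where such a path can live = module III's wording (class-space chord, or TUNED fine-space path — LENS control N1); support-matched case only; nothing of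
Bałaban's instantiated; NE7 NOT proved; N19 NOT discharged (0∕1); K3⁗ NOT claimed; counts UNMOVED (typed 28∕28 · discharged 5∕27 · A 5∕28); one finite
four-torus programme at fixed `ε` — NOT ℝ⁴, NOT OS, NOT a mass gap, NOT Clay.  0 `def`; 0 `sorry`; standard axioms.
-/

set_option autoImplicit false

noncomputable section

open MeasureTheory ProbabilityTheory Set Filter Topology
open scoped ENNReal

namespace Summit.QuantumFields.YangMills.BalabanUVNodes.N19TiltPathLeaf

open Summit.QuantumFields.BalabanUV.T4Continuum.NE1p.DressedMGFForm (MGFForm)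
open Summit.QuantumFields.BalabanUV.T4Continuum.Spine.NE7 (Core PathLeaf core_of_pathLeaf)
open Summit.QuantumFields.YangMills.BalabanUVNodes.N19TiltPathCalculus
open Summit.QuantumFields.YangMills.BalabanUVNodes.N19TiltPathRoad (integrable_exp_of_bounds)

/-! ## §1 A bounded re-tilt moves a mean by at most `e^{2C}` × the L¹-oscillation -/
section Retilt

variable {Ω : Type*} [MeasurableSpace Ω] {ν : Measure Ω} [IsProbabilityMeasure ν] {g V : Ω → ℝ} {C : ℝ}

/-- **DRESSING A MEAN COSTS `e^{2C}·osc`.**  For a probability law `ν`, an integrable `g` and a bounded measurable re-tilt `V` (`|V| ≤ C`):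
`|∫ g d(ν.tilted V) − ∫ g dν| ≤ e^{2C}·∫|g − ∫g dν| dν` — the difference is `Cov_ν(e^{V}, g) ∕ E_ν[e^{V}]`, numerator `≤ e^{C}·osc(g)`
(module I `abs_cov_le_mul_integral_abs_sub`), denominator `≥ e^{−C}`. [folklore] -/
theorem abs_integral_tilted_sub_integral_le_exp_mul_osc (hgm : Measurable g) {Cg : ℝ} (hgb : ∀ x, |g x| ≤ Cg)
    (hVm : Measurable V) (hVb : ∀ x, |V x| ≤ C) :
    |∫ x, g x ∂(ν.tilted V) - ∫ x, g x ∂ν| ≤ Real.exp (2 * C) * ∫ x, |g x - ∫ y, g y ∂ν| ∂ν := by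
  have hgi : Integrable g ν := integrable_of_abs_le hgm hgb
  have hem : Measurable fun x => Real.exp (V x) := Real.measurable_exp.comp hVm
  have heb : ∀ x, |Real.exp (V x)| ≤ Real.exp C := fun x => by
    rw [Real.abs_exp]; exact Real.exp_le_exp.2 ((le_abs_self _).trans (hVb x))
  have hei : Integrable (fun x => Real.exp (V x)) ν := integrable_of_abs_le hem heb
  have hZlo : Real.exp (-C) ≤ ∫ x, Real.exp (V x) ∂ν := by
    calc Real.exp (-C) = ∫ x, Real.exp (-C) ∂ν := by rw [integral_const, smul_eq_mul, probReal_univ, one_mul]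
      _ ≤ ∫ x, Real.exp (V x) ∂ν := integral_mono (integrable_const _) hei fun x =>
          Real.exp_le_exp.2 (by linarith [abs_le.mp (hVb x)])
  have hZpos : 0 < ∫ x, Real.exp (V x) ∂ν := (Real.exp_pos _).trans_le hZlo
  -- the difference as a covariance quotient
  have hdiff : ∫ x, g x ∂(ν.tilted V) - ∫ x, g x ∂ν = cov[fun x => Real.exp (V x), g; ν] / ∫ x, Real.exp (V x) ∂ν := by
    rw [covariance_eq_integral_mul_sub hem heb hgi, integral_tilted_eq_div, eq_div_iff hZpos.ne', sub_mul,
      div_mul_cancel₀ _ hZpos.ne']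
    have hgc : Integrable (fun x => g x - ∫ y, g y ∂ν) ν := hgi.sub (integrable_const _)
    have e : (fun x => Real.exp (V x) * (g x - ∫ y, g y ∂ν)) = fun x => g x * Real.exp (V x) - (∫ y, g y ∂ν) * Real.exp (V x) := by
      ext x; ring
    rw [e, integral_sub (hei.bdd_mul hgm.aestronglyMeasurable (Eventually.of_forall fun x => by
      rw [Real.norm_eq_abs]; exact hgb x)) (hei.const_mul _), integral_const_mul]
  rw [hdiff, abs_div, abs_of_pos hZpos, div_le_iff₀ hZpos]
  calc |cov[fun x => Real.exp (V x), g; ν]| ≤ Real.exp C * ∫ x, |g x - ∫ y, g y ∂ν| ∂ν :=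
        abs_cov_le_mul_integral_abs_sub hem heb hgi
    _ = Real.exp (2 * C) * (∫ x, |g x - ∫ y, g y ∂ν| ∂ν) * Real.exp (-C) := by
        have h2 : Real.exp (2 * C) * Real.exp (-C) = Real.exp C := by rw [← Real.exp_add]; ring_nf
        symm; rw [mul_right_comm, h2]
    _ ≤ Real.exp (2 * C) * (∫ x, |g x - ∫ y, g y ∂ν| ∂ν) * ∫ x, Real.exp (V x) ∂ν :=
        mul_le_mul_of_nonneg_left hZlo (mul_nonneg (Real.exp_pos _).le (integral_nonneg fun x => abs_nonneg _))

end Retilt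

/-! ## §2 One class: the DRESSED mass along a tilt path is a positive C¹ path whose log-derivative is the dressed tilted mean of the direction -/
section Dressed

variable {Ω : Type*} [MeasurableSpace Ω] {μ : Measure Ω} [IsFiniteMeasure μ] [NeZero μ]
  {ψ ψ' : ℝ → Ω → ℝ} {W : Ω → ℝ} {B t : ℝ}

omit [MeasurableSpace Ω] [IsFiniteMeasure μ] [NeZero μ] in
/-- Shifting a tilt path by a fixed bounded measurable dressing `t·W` is again a tilt path (same direction). [folklore] -/
theorem tiltPath_bounds_add_dressing
    (hbd : ∀ u₀ : ℝ, ∃ ε > 0, ∃ M : ℝ, ∀ u ∈ Metric.ball u₀ ε, ∀ x, |ψ u x| ≤ M ∧ |ψ' u x| ≤ M)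
    (hWb : ∀ x, |W x| ≤ B) (u₀ : ℝ) :
    ∃ ε > 0, ∃ M : ℝ, ∀ u ∈ Metric.ball u₀ ε, ∀ x, |ψ u x + t * W x| ≤ M ∧ |ψ' u x| ≤ M := by
  obtain ⟨ε, hε, M, hM⟩ := hbd u₀
  refine ⟨ε, hε, M + |t| * |B|, fun u hu x => ⟨?_, ?_⟩⟩
  · calc |ψ u x + t * W x| ≤ |ψ u x| + |t * W x| := abs_add_le _ _
      _ ≤ M + |t| * |B| := by
          rw [abs_mul]
          exact add_le_add (hM u hu x).1 (mul_le_mul_of_nonneg_left ((hWb x).trans (le_abs_self B)) (abs_nonneg t))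
  · exact (hM u hu x).2.trans (le_add_of_nonneg_right (mul_nonneg (abs_nonneg _) (abs_nonneg _)))

/-- **THE DRESSED MASS PATH.**  Along a tilt path, for a bounded measurable dressing `W` and any `t`, the dressed mass `ρ u = ∫ e^{ψ_u + tW} dμ` is positive,
differentiable with `ρ′ u = ∫ e^{ψ_u + tW}·ψ′_u dμ`, and `ρ′ u ∕ ρ u = ∫ ψ′_u d(μ.tilted (ψ u + tW))` — the DRESSED tilted mean of the direction. [folklore ∘ module I §1] -/
theorem dressedMass_hasDerivAt (hψm : ∀ u, Measurable (ψ u)) (hψ'm : ∀ u, Measurable (ψ' u))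
    (hψd : ∀ u x, HasDerivAt (fun v => ψ v x) (ψ' u x) u)
    (hbd : ∀ u₀ : ℝ, ∃ ε > 0, ∃ M : ℝ, ∀ u ∈ Metric.ball u₀ ε, ∀ x, |ψ u x| ≤ M ∧ |ψ' u x| ≤ M)
    (hWm : Measurable W) (hWb : ∀ x, |W x| ≤ B) (u : ℝ) :
    0 < ∫ x, Real.exp (ψ u x + t * W x) ∂μ ∧
      HasDerivAt (fun v => ∫ x, Real.exp (ψ v x + t * W x) ∂μ) (∫ x, Real.exp (ψ u x + t * W x) * ψ' u x ∂μ) u ∧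
      (∫ x, Real.exp (ψ u x + t * W x) * ψ' u x ∂μ) / (∫ x, Real.exp (ψ u x + t * W x) ∂μ) =
        ∫ x, ψ' u x ∂(μ.tilted fun x => ψ u x + t * W x) := by
  have hbd' := tiltPath_bounds_add_dressing (t := t) hbd hWb
  have hm' : ∀ v, Measurable fun x => ψ v x + t * W x := fun v => (hψm v).add (measurable_const.mul hWm)
  have hd' : ∀ v x, HasDerivAt (fun w => ψ w x + t * W x) (ψ' v x) v := fun v x => (hψd v x).add_const _
  refine ⟨integral_exp_pos (integrable_exp_of_bounds (ψ' := ψ') hm' hbd' u), ?_, ?_⟩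
  · have h := hasDerivAt_integral_mul_exp_tiltPath (μ := μ) (ψ := fun v x => ψ v x + t * W x) (f := fun _ => (1 : ℝ)) (B := 1)
      hm' hψ'm hd' (hbd' u) measurable_const (fun _ => by simp)
    simp only [one_mul] at h
    exact h
  · rw [integral_tilted_eq_div]
    congr 1
    exact integral_congr_ae (Eventually.of_forall fun x => by ring)

/-- **THE DRESSED DRIFT IS THE UNDRESSED DRIFT UP TO `e^{2|t|B}·osc`.**  `|∫ψ′_u d(μ.tilted (ψ u + tW)) − k′| ≤ e^{2|t|B}·osc_u(ψ′_u) + r` whenever the UNDRESSED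
tilted mean is within `r` of `k′` (§1 applied to the probability law `μ.tilted (ψ u)` and the re-tilt `tW`, Mathlib `tilted_tilted`). [folklore] -/
theorem abs_dressedDrift_le (hψm : ∀ u, Measurable (ψ u)) (hψ'm : ∀ u, Measurable (ψ' u))
    (hbd : ∀ u₀ : ℝ, ∃ ε > 0, ∃ M : ℝ, ∀ u ∈ Metric.ball u₀ ε, ∀ x, |ψ u x| ≤ M ∧ |ψ' u x| ≤ M)
    (hWm : Measurable W) (hWb : ∀ x, |W x| ≤ B) (u : ℝ) {k' r : ℝ}
    (hdrift : |∫ x, ψ' u x ∂(μ.tilted (ψ u)) - k'| ≤ r) :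
    |∫ x, ψ' u x ∂(μ.tilted fun x => ψ u x + t * W x) - k'| ≤
      Real.exp (2 * (|t| * B)) * ∫ x, |ψ' u x - ∫ y, ψ' u y ∂(μ.tilted (ψ u))| ∂(μ.tilted (ψ u)) + r := by
  obtain ⟨ε, hε, M, hM⟩ := hbd u
  have hexp : Integrable (fun x => Real.exp (ψ u x)) μ := integrable_exp_of_bounds (ψ' := ψ') hψm hbd u
  haveI : IsProbabilityMeasure (μ.tilted (ψ u)) := isProbabilityMeasure_tilted hexp
  have htt : (μ.tilted fun x => ψ u x + t * W x) = (μ.tilted (ψ u)).tilted fun x => t * W x := by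
    rw [tilted_tilted hexp]; rfl
  rw [htt]
  have hVm : Measurable fun x => t * W x := measurable_const.mul hWm
  have hVb : ∀ x, |t * W x| ≤ |t| * B := fun x => by
    rw [abs_mul]; exact mul_le_mul_of_nonneg_left (hWb x) (abs_nonneg t)
  have h1 := abs_integral_tilted_sub_integral_le_exp_mul_osc (ν := μ.tilted (ψ u)) (hψ'm u)
    (fun x => (hM u (Metric.mem_ball_self hε) x).2) hVm hVb
  calc |∫ x, ψ' u x ∂((μ.tilted (ψ u)).tilted fun x => t * W x) - k'|
      ≤ |∫ x, ψ' u x ∂((μ.tilted (ψ u)).tilted fun x => t * W x) - ∫ x, ψ' u x ∂(μ.tilted (ψ u))| +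
          |∫ x, ψ' u x ∂(μ.tilted (ψ u)) - k'| := abs_sub_le _ _ _
    _ ≤ _ := add_le_add h1 hdrift

end Dressed

/-! ## §3 Class level: the annealed tilt-path data INHABIT the H1L route's `Spine.NE7.PathLeaf` BY NAME -/
section Leaf

variable {ι : Type*} [DecidableEq ι] {Ω : ℕ → Type*} [∀ K, MeasurableSpace (Ω K)]
  {l₀ vol B : ℝ} {T : ℕ → Finset ι} {Bad : ℕ → ℝ → Finset ι} {W : ∀ K, Ω K → ℝ}
  {μA μB : ∀ K, ι → Measure (Ω K)} {P Q : ℕ → ℝ → ι → ℝ} {δ r₁ ρ : ℕ → ℝ}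
  {Ψ Ψ' : ∀ K, ι → ℝ → Ω K → ℝ} {k k' : ℕ → ℝ → ℝ}

/-- ★★ **THE ANNEALED DATA PRODUCE `Spine.NE7.PathLeaf`** (ROUTES-NE7 §L1.1's named output shape, `Spine/NE7/Targets` §3).  Setting of
`N19TiltPathRoad.core_of_tiltPath` with the good classes NON-NULL (`PathLeaf` demands positive paths) and the width budget
`r₁ K + 2·e^{2l₀B}·ρ K ≤ vol·δ K`: for every `K` the drift `φ := k_K` (derivative `k′_K` within `[0,1]`), and for every good class and `|t| ≤ l₀` the
DRESSED MASS PATH `σ ↦ ∫ e^{Ψ K τ σ + t·W K} dμA K τ` from `P K t τ` (run A's dressed class term) to `Q K t τ` (run B's), positive and C¹, with log-derivative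
within `vol·δ K` of `k′_K(σ)` (§2).  Hence `Core` again by the tree's `core_of_pathLeaf` (`core_of_tiltPath_via_pathLeaf`; constant `2e^{2l₀B}` in place of
module III's `e^{2l₀B} − 1`, which integrates the dressing instead of differentiating it). [folklore ∘ §2] -/
theorem pathLeaf_of_tiltPath (hP : MGFForm B T W μA P) (hQ : MGFForm B T W μB Q)
    (hΨm : ∀ K τ u, Measurable (Ψ K τ u)) (hΨ'm : ∀ K τ u, Measurable (Ψ' K τ u))
    (hΨd : ∀ K τ u x, HasDerivAt (fun v => Ψ K τ v x) (Ψ' K τ u x) u)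
    (hbd : ∀ K τ (u₀ : ℝ), ∃ ε > 0, ∃ M : ℝ, ∀ u ∈ Metric.ball u₀ ε, ∀ x, |Ψ K τ u x| ≤ M ∧ |Ψ' K τ u x| ≤ M)
    (hΨ0 : ∀ K τ x, Ψ K τ 0 x = 0)
    (hB : ∀ K, ∀ τ ∈ T K, μB K τ = (μA K τ).withDensity fun x => ENNReal.ofReal (Real.exp (Ψ K τ 1 x)))
    (hk : ∀ K, ∀ u ∈ Icc (0 : ℝ) 1, HasDerivWithinAt (k K) (k' K u) (Icc (0 : ℝ) 1) u)
    (hpos : ∀ (K : ℕ) (t : ℝ), |t| ≤ l₀ → ∀ τ ∈ T K \ Bad K t, μA K τ ≠ 0)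
    (hdrift : ∀ (K : ℕ) (t : ℝ), |t| ≤ l₀ → ∀ τ ∈ T K \ Bad K t, μA K τ ≠ 0 → ∀ u ∈ Icc (0 : ℝ) 1,
      |∫ x, Ψ' K τ u x ∂((μA K τ).tilted (Ψ K τ u)) - k' K u| ≤ r₁ K)
    (hosc : ∀ (K : ℕ) (t : ℝ), |t| ≤ l₀ → ∀ τ ∈ T K \ Bad K t, μA K τ ≠ 0 → ∀ u ∈ Icc (0 : ℝ) 1,
      ∫ x, |Ψ' K τ u x - ∫ y, Ψ' K τ u y ∂((μA K τ).tilted (Ψ K τ u))| ∂((μA K τ).tilted (Ψ K τ u)) ≤ 2 * ρ K)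
    (hw : ∀ K, r₁ K + 2 * Real.exp (2 * (l₀ * B)) * ρ K ≤ vol * δ K) :
    PathLeaf l₀ vol T Bad P Q δ := by
  intro K
  refine ⟨k K, k' K, hk K, fun t ht τ hτ => ?_⟩
  have hτT : τ ∈ T K := (Finset.mem_sdiff.mp hτ).1
  haveI := hP.finite K τ hτT
  have h0 := hpos K t ht τ hτ
  haveI : NeZero (μA K τ) := ⟨h0⟩
  have hWm := hP.meas K
  have hWb := hP.bound K
  have hl₀ : 0 ≤ l₀ := (abs_nonneg t).trans ht
  have hBnn : 0 ≤ B := hP.nonneg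
  have hD := fun u => dressedMass_hasDerivAt (μ := μA K τ) (t := t) (hΨm K τ) (hΨ'm K τ) (hΨd K τ) (hbd K τ) hWm hWb u
  refine ⟨fun u => ∫ x, Real.exp (Ψ K τ u x + t * W K x) ∂(μA K τ),
    fun u => ∫ x, Real.exp (Ψ K τ u x + t * W K x) * Ψ' K τ u x ∂(μA K τ), ?_, ?_, fun u _ => ⟨(hD u).1, (hD u).2.1.hasDerivWithinAt⟩,
    fun u hu => ?_⟩
  · -- start: `P K t τ = mgf (W K) (μA K τ) t`
    show ∫ x, Real.exp (Ψ K τ 0 x + t * W K x) ∂(μA K τ) = P K t τ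
    rw [hP.repr K t τ hτT]
    simp only [hΨ0, zero_add, mgf]
  · -- end: `Q K t τ = mgf (W K) (μB K τ) t = ∫ e^{Ψ 1} e^{tW} dμA`
    show ∫ x, Real.exp (Ψ K τ 1 x + t * W K x) ∂(μA K τ) = Q K t τ
    have hmeas : Measurable fun x => Real.exp (Ψ K τ 1 x) := Real.measurable_exp.comp (hΨm K τ 1)
    rw [hQ.repr K t τ hτT, hB K τ hτT]
    simp only [mgf]
    rw [Literature.MathematicalPhysics.QuantumFieldTheory.Balaban1983to89.T4VarianceMatching.integral_withDensity_ofReal_mul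
        (g := fun x => Real.exp (Ψ K τ 1 x)) hmeas (fun x => (Real.exp_pos _).le)]
    exact integral_congr_ae (Eventually.of_forall fun x => by simp only [Real.exp_add])
  · rw [(hD u).2.2]
    have hdd := abs_dressedDrift_le (μ := μA K τ) (t := t) (hΨm K τ) (hΨ'm K τ) (hbd K τ) hWm hWb u (hdrift K t ht τ hτ h0 u hu)
    refine hdd.trans ?_
    have hexp_le : Real.exp (2 * (|t| * B)) ≤ Real.exp (2 * (l₀ * B)) :=
      Real.exp_le_exp.2 (by nlinarith [abs_nonneg t])
    have hosc' := hosc K t ht τ hτ h0 u hu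
    have hoscnn : 0 ≤ ∫ x, |Ψ' K τ u x - ∫ y, Ψ' K τ u y ∂((μA K τ).tilted (Ψ K τ u))| ∂((μA K τ).tilted (Ψ K τ u)) :=
      integral_nonneg fun x => abs_nonneg _
    nlinarith [hw K, Real.exp_pos (2 * (l₀ * B)), Real.exp_pos (2 * (|t| * B))]

/-- `Core` BY THE ROUTE's NAMED FACE: `Spine.NE7.core_of_pathLeaf ∘ pathLeaf_of_tiltPath` (same data as module III's `core_of_tiltPath` plus non-null good classes;
width `r₁ + 2e^{2l₀B}ρ`). [bookkeeping] -/
theorem core_of_tiltPath_via_pathLeaf (hP : MGFForm B T W μA P) (hQ : MGFForm B T W μB Q)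
    (hΨm : ∀ K τ u, Measurable (Ψ K τ u)) (hΨ'm : ∀ K τ u, Measurable (Ψ' K τ u))
    (hΨd : ∀ K τ u x, HasDerivAt (fun v => Ψ K τ v x) (Ψ' K τ u x) u)
    (hbd : ∀ K τ (u₀ : ℝ), ∃ ε > 0, ∃ M : ℝ, ∀ u ∈ Metric.ball u₀ ε, ∀ x, |Ψ K τ u x| ≤ M ∧ |Ψ' K τ u x| ≤ M)
    (hΨ0 : ∀ K τ x, Ψ K τ 0 x = 0)
    (hB : ∀ K, ∀ τ ∈ T K, μB K τ = (μA K τ).withDensity fun x => ENNReal.ofReal (Real.exp (Ψ K τ 1 x)))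
    (hk : ∀ K, ∀ u ∈ Icc (0 : ℝ) 1, HasDerivWithinAt (k K) (k' K u) (Icc (0 : ℝ) 1) u)
    (hpos : ∀ (K : ℕ) (t : ℝ), |t| ≤ l₀ → ∀ τ ∈ T K \ Bad K t, μA K τ ≠ 0)
    (hdrift : ∀ (K : ℕ) (t : ℝ), |t| ≤ l₀ → ∀ τ ∈ T K \ Bad K t, μA K τ ≠ 0 → ∀ u ∈ Icc (0 : ℝ) 1,
      |∫ x, Ψ' K τ u x ∂((μA K τ).tilted (Ψ K τ u)) - k' K u| ≤ r₁ K)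
    (hosc : ∀ (K : ℕ) (t : ℝ), |t| ≤ l₀ → ∀ τ ∈ T K \ Bad K t, μA K τ ≠ 0 → ∀ u ∈ Icc (0 : ℝ) 1,
      ∫ x, |Ψ' K τ u x - ∫ y, Ψ' K τ u y ∂((μA K τ).tilted (Ψ K τ u))| ∂((μA K τ).tilted (Ψ K τ u)) ≤ 2 * ρ K)
    (hw : ∀ K, r₁ K + 2 * Real.exp (2 * (l₀ * B)) * ρ K ≤ vol * δ K) :
    Core l₀ vol T Bad P Q δ :=
  core_of_pathLeaf (pathLeaf_of_tiltPath hP hQ hΨm hΨ'm hΨd hbd hΨ0 hB hk hpos hdrift hosc hw)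

end Leaf

end Summit.QuantumFields.YangMills.BalabanUVNodes.N19TiltPathLeaf

end
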